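import Literature.NumberTheory.LFunctions.SoundararajanContourDyadic
import HarnessLib

/-!
# Soundararajan's contour: the largeness conditions hold eventually

Topic `Literature/NumberTheory/LFunctions`; a brick of the reduction of
`Literature.NumberTheory.LFunctions.BalazardDeRoton2010_thm1` to the engine statements of
Soundararajan's method. Every "`T` assez grand" / "`N` assez grand" of M. Balazard, A. de Roton,
arXiv:0810.3587 §8 and arXiv:0812.1689 §6.2 was rendered in `SoundararajanContour.lean` and
`SoundararajanContourDyadic.lean` by explicit elementary inequalities (`GoodSize`, `GoodCount`,
`MidGood`, `LargeN`); here we check that they hold beyond some threshold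
(`exists_goodSize`, `exists_goodCount`, `exists_midGood`, `eventually_largeN`), by the standard
limits `log x → ∞`, `(log x)^r = o(x^s)`, `x^n e^{-x} → 0`.

## References

* [BalazardRoton2008] M. Balazard, A. de Roton, arXiv:0810.3587, §8 ("`N` assez grand").
* [BalazardDeRoton2010] M. Balazard, A. de Roton, arXiv:0812.1689, §6.2.
-/

noncomputable section

open Real Filter Topology Asymptotics

namespace Literature.NumberTheory.LFunctions

namespace SoundContour

open TypicalPointwise TypicalLadder TypicalCounting

/-! ### Filter helpers -/

/-- `log log t → ∞`. [folklore] -/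
lemma tendsto_loglog_atTop : Tendsto (fun t : ℝ ↦ Real.log (Real.log t)) atTop atTop :=
  Real.tendsto_log_atTop.comp Real.tendsto_log_atTop

/-- `log log log t → ∞`. [folklore] -/
lemma tendsto_logloglog_atTop : Tendsto (fun t : ℝ ↦ Real.log (Real.log (Real.log t))) atTop atTop :=
  Real.tendsto_log_atTop.comp tendsto_loglog_atTop

/-- `log u ≤ ε u` eventually. [folklore] -/
lemma eventually_log_le_mul {ε : ℝ} (hε : 0 < ε) : ∀ᶠ u : ℝ in atTop, Real.log u ≤ ε * u := by
  have h := Real.isLittleO_log_id_atTop.def hε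
  filter_upwards [h, eventually_ge_atTop (1 : ℝ)] with u hu hu1
  rw [Real.norm_eq_abs, Real.norm_eq_abs, abs_of_nonneg (Real.log_nonneg hu1), id,
    abs_of_nonneg (by linarith)] at hu
  exact hu

/-- `(log u)^n ≤ ε u^{1/2}` eventually (`n` a natural number). [folklore] -/
lemma eventually_log_pow_le_mul_sqrt (n : ℕ) {ε : ℝ} (hε : 0 < ε) :
    ∀ᶠ u : ℝ in atTop, Real.log u ^ n ≤ ε * u ^ (1 / 2 : ℝ) := by
  have h := (isLittleO_log_rpow_rpow_atTop (s := 1 / 2) (n : ℝ) (by norm_num)).def hε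
  filter_upwards [h, eventually_ge_atTop (1 : ℝ)] with u hu hu1
  rw [Real.norm_eq_abs, Real.norm_eq_abs, Real.rpow_natCast, abs_of_nonneg (pow_nonneg (Real.log_nonneg hu1) n),
    abs_of_nonneg (Real.rpow_nonneg (by linarith) _)] at hu
  exact hu

/-- `C u^n ≤ exp u` eventually. [folklore] -/
lemma eventually_mul_pow_le_exp (C : ℝ) (n : ℕ) : ∀ᶠ u : ℝ in atTop, C * u ^ n ≤ Real.exp u := by
  have h := Real.tendsto_pow_mul_exp_neg_atTop_nhds_zero n
  have hε : (0 : ℝ) < 1 / (|C| + 1) := by positivity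
  have h2 := (tendsto_order.1 h).2 _ hε
  filter_upwards [h2, eventually_ge_atTop (0 : ℝ)] with u hu hu0
  have hexp := Real.exp_pos u
  have hun : 0 ≤ u ^ n := pow_nonneg hu0 n
  -- `u^n ≤ e^u/(|C|+1)`
  have h3 : u ^ n ≤ Real.exp u / (|C| + 1) := by
    rw [le_div_iff₀ (by positivity)]
    have : u ^ n * Real.exp (-u) * Real.exp u < 1 / (|C| + 1) * Real.exp u :=
      mul_lt_mul_of_pos_right hu hexp
    rw [mul_assoc, ← Real.exp_add, neg_add_cancel, Real.exp_zero, mul_one] at this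
    rw [div_mul_eq_mul_div, one_mul, lt_div_iff₀ (by positivity)] at this
    linarith
  calc C * u ^ n ≤ |C| * u ^ n := mul_le_mul_of_nonneg_right (le_abs_self C) hun
    _ ≤ (|C| + 1) * u ^ n := by nlinarith
    _ ≤ (|C| + 1) * (Real.exp u / (|C| + 1)) := mul_le_mul_of_nonneg_left h3 (by positivity)
    _ = Real.exp u := by field_simp

/-! ### The size thresholds -/

/-- `GoodSize` holds beyond some threshold. [folklore] -/
theorem exists_goodSize (T₁ T₁₈ : ℝ) : ∃ t₁ : ℝ, ∀ t : ℝ, t₁ ≤ t → GoodSize T₁ T₁₈ t := by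
  -- the conditions, in terms of `u = log t`, `v = log u`, `w = log v`
  have h1 : ∀ᶠ t : ℝ in atTop, T₁ ≤ t := eventually_ge_atTop T₁
  have h2 : ∀ᶠ t : ℝ in atTop, T₁₈ ≤ t := eventually_ge_atTop T₁₈
  have h3 : ∀ᶠ t : ℝ in atTop, Real.exp (Real.exp 2) ≤ t := eventually_ge_atTop _
  have h4 : ∀ᶠ t : ℝ in atTop, 1 ≤ Real.log (Real.log (Real.log t)) :=
    tendsto_logloglog_atTop.eventually_ge_atTop 1
  have h5 : ∀ᶠ t : ℝ in atTop, 1 ≤ Real.log (Real.log t) := tendsto_loglog_atTop.eventually_ge_atTop 1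
  -- `L₃/L₂ ≤ 1/4`
  have h6 : ∀ᶠ t : ℝ in atTop, Real.log (Real.log (Real.log t)) ≤ (1 / 4) * Real.log (Real.log t) :=
    tendsto_loglog_atTop.eventually (eventually_log_le_mul (by norm_num))
  -- `(L₂ t)^3 ≤ (1/4) log t` (from `(log u)^3 ≤ (1/4) u` with `u = log t`)
  have h7 : ∀ᶠ t : ℝ in atTop, Real.log (Real.log t) ^ 3 ≤ (1 / 4) * Real.log t := by
    have : ∀ᶠ u : ℝ in atTop, Real.log u ^ 3 ≤ (1 / 4) * u := by
      filter_upwards [eventually_log_pow_le_mul_sqrt 3 (show (0 : ℝ) < 1 / 4 by norm_num),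
        eventually_ge_atTop (1 : ℝ)] with u hu hu1
      have : u ^ (1 / 2 : ℝ) ≤ u := by
        calc u ^ (1 / 2 : ℝ) ≤ u ^ (1 : ℝ) := Real.rpow_le_rpow_of_exponent_le hu1 (by norm_num)
          _ = u := Real.rpow_one u
      nlinarith
    exact Real.tendsto_log_atTop.eventually this
  obtain ⟨t₁, ht₁⟩ := Filter.eventually_atTop.1 (h1.and (h2.and (h3.and (h4.and (h5.and (h6.and h7))))))
  refine ⟨t₁, fun t ht ↦ ?_⟩
  obtain ⟨a1, a2, a3, a4, a5, a6, a7⟩ := ht₁ t ht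
  set u := Real.log t
  set v := Real.log u
  set w := Real.log v
  have hv0 : 0 < v := by linarith
  have hwv : 0 ≤ w / v := by positivity
  have hwv4 : w / v ≤ 1 / 4 := by rw [div_le_iff₀ hv0]; linarith
  have hu0 : 0 < u := by nlinarith [pow_pos hv0 3]
  refine ⟨a1, a2, a3, by linarith, ?_, ?_⟩
  · -- `v² ≤ (1/2 + w/v) u/v`  ⇐  `v³ ≤ u/2`
    rw [le_div_iff₀ hv0]
    have : v ^ 2 * v = v ^ 3 := by ring
    nlinarith
  · -- `(1/2 + w/v) u/v + 1 ≤ u/v`  ⇐  `w/v ≤ 1/4`, `4v ≤ u`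
    rw [div_add_one hv0.ne', div_le_div_iff_of_pos_right hv0]
    have h4v : 4 * v ≤ u := by nlinarith [pow_pos hv0 2]
    nlinarith

/-- `GoodCount` holds beyond some threshold. [folklore] -/
theorem exists_goodCount (δ D₂₀ T₂₀ : ℝ) : ∃ t₂ : ℝ, ∀ t : ℝ, t₂ ≤ t → GoodCount δ D₂₀ T₂₀ t := by
  have h1 : ∀ᶠ t : ℝ in atTop, T₂₀ ≤ t := eventually_ge_atTop T₂₀
  have h2 : ∀ᶠ t : ℝ in atTop, 4 ≤ Real.log (Real.log t) := tendsto_loglog_atTop.eventually_ge_atTop 4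
  have h3 : ∀ᶠ t : ℝ in atTop, 4 / δ ^ 2 + (2 + |D₂₀|) / δ ≤ Real.log (Real.log t) ^ 2 :=
    ((tendsto_pow_atTop two_ne_zero).comp tendsto_loglog_atTop).eventually_ge_atTop _
  have h4 : ∀ᶠ t : ℝ in atTop, Real.exp (16384 + |D₂₀|) ≤ Real.log (Real.log t) :=
    tendsto_loglog_atTop.eventually_ge_atTop _
  obtain ⟨t₂, ht₂⟩ := Filter.eventually_atTop.1 (h1.and (h2.and (h3.and h4)))
  exact ⟨t₂, fun t ht ↦ let ⟨a1, a2, a3, a4⟩ := ht₂ t ht; ⟨a1, a2, a3, a4⟩⟩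

/-- `MidGood` holds beyond some threshold. [folklore] -/
theorem exists_midGood (T₁ T₁₈ : ℝ) : ∃ t₃ : ℝ, ∀ t : ℝ, t₃ ≤ t → MidGood T₁ T₁₈ t := by
  have h1 : ∀ᶠ t : ℝ in atTop, T₁ ≤ t := eventually_ge_atTop T₁
  have h2 : ∀ᶠ t : ℝ in atTop, T₁₈ ≤ t := eventually_ge_atTop T₁₈
  have h3 : ∀ᶠ t : ℝ in atTop, 4 ≤ Real.log (Real.log t) := tendsto_loglog_atTop.eventually_ge_atTop 4
  have h4 : ∀ᶠ t : ℝ in atTop, Real.log (Real.log (Real.log t)) ≤ (1 / 2) * Real.log (Real.log t) :=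
    tendsto_loglog_atTop.eventually (eventually_log_le_mul (by norm_num))
  have h5 : ∀ᶠ t : ℝ in atTop, Real.log (Real.log t) ^ 3 ≤ Real.log t := by
    have : ∀ᶠ u : ℝ in atTop, Real.log u ^ 3 ≤ u := by
      filter_upwards [eventually_log_pow_le_mul_sqrt 3 (show (0 : ℝ) < 1 by norm_num),
        eventually_ge_atTop (1 : ℝ)] with u hu hu1
      have : u ^ (1 / 2 : ℝ) ≤ u := by
        calc u ^ (1 / 2 : ℝ) ≤ u ^ (1 : ℝ) := Real.rpow_le_rpow_of_exponent_le hu1 (by norm_num)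
          _ = u := Real.rpow_one u
      linarith
    exact Real.tendsto_log_atTop.eventually this
  obtain ⟨t₃, ht₃⟩ := Filter.eventually_atTop.1 (h1.and (h2.and (h3.and (h4.and h5))))
  refine ⟨t₃, fun t ht ↦ ?_⟩
  obtain ⟨a1, a2, a3, a4, a5⟩ := ht₃ t ht
  exact ⟨a1, a2, a3, by linarith, a5⟩

/-! ### `LargeN` eventually -/

/-- `log N → ∞` along the naturals. [folklore] -/
lemma tendsto_log_nat : Tendsto (fun N : ℕ ↦ Real.log N) atTop atTop :=
  Real.tendsto_log_atTop.comp tendsto_natCast_atTop_atTop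

/-- `y(N) → ∞`. [folklore] -/
lemma tendsto_yPar : Tendsto yPar atTop atTop := by
  have h1 : Tendsto (fun N : ℕ ↦ Real.log N ^ (1 / 2 : ℝ)) atTop atTop :=
    (tendsto_rpow_atTop (by norm_num)).comp tendsto_log_nat
  have h2 : Tendsto (fun N : ℕ ↦ Real.log (Real.log N) ^ (5 / 2 : ℝ)) atTop atTop :=
    (tendsto_rpow_atTop (by norm_num)).comp (Real.tendsto_log_atTop.comp tendsto_log_nat)
  exact h1.atTop_mul_atTop₀ h2

/-- **"`N` assez grand": all conditions of `LargeN` hold eventually.** [folklore] -/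
theorem eventually_largeN (δ D C D₂₀ Ca : ℝ) (M : ℕ) (tthr : ℝ) (hδ0 : 0 < δ) :
    ∃ N₁ : ℕ, ∀ N : ℕ, N₁ ≤ N → LargeN δ D C D₂₀ Ca M tthr N := by
  have hu := tendsto_log_nat
  have hv : Tendsto (fun N : ℕ ↦ Real.log (Real.log N)) atTop atTop := Real.tendsto_log_atTop.comp hu
  have hw : Tendsto (fun N : ℕ ↦ Real.log (Real.log (Real.log N))) atTop atTop :=
    Real.tendsto_log_atTop.comp hv
  have cN : ∀ᶠ N : ℕ in atTop, 2 ^ 32 ≤ N := eventually_ge_atTop _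
  have cy2 : ∀ᶠ N : ℕ in atTop, 2 ≤ yPar N := tendsto_yPar.eventually_ge_atTop 2
  have cythr : ∀ᶠ N : ℕ in atTop, tthr ≤ yPar N := tendsto_yPar.eventually_ge_atTop tthr
  have cv6 : ∀ᶠ N : ℕ in atTop, 6 ≤ Real.log (Real.log N) := hv.eventually_ge_atTop 6
  -- `y + 1 ≤ u`: from `(L₂N)^{5/2} ≤ ½ (log N)^{1/2}` and `2 ≤ u`
  have cyu : ∀ᶠ N : ℕ in atTop, yPar N + 1 ≤ Real.log N := by
    have h := (isLittleO_log_rpow_rpow_atTop (s := 1 / 2) (5 / 2 : ℝ) (by norm_num)).def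
      (show (0 : ℝ) < 1 / 2 by norm_num)
    have h' := hu.eventually h
    filter_upwards [h', hu.eventually_ge_atTop (4 : ℝ)] with N hN hu4
    have hlog0 : 0 ≤ Real.log (N : ℝ) := by linarith
    have hll0 : 0 ≤ Real.log (Real.log (N : ℝ)) := Real.log_nonneg (by linarith)
    simp only [Real.norm_eq_abs] at hN
    rw [abs_of_nonneg (Real.rpow_nonneg hll0 _), abs_of_nonneg (Real.rpow_nonneg hlog0 _)] at hN
    have hs : Real.log (N : ℝ) ^ (1 / 2 : ℝ) * Real.log (N : ℝ) ^ (1 / 2 : ℝ) = Real.log N := by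
      rw [← Real.rpow_add (by linarith)]; norm_num
    have hs0 : 0 ≤ Real.log (N : ℝ) ^ (1 / 2 : ℝ) := Real.rpow_nonneg hlog0 _
    unfold yPar
    have := mul_le_mul_of_nonneg_left hN hs0
    nlinarith
  -- `c1`, `c8`: `log v ≤ v/640`-type bounds with `v = L₂ N`
  have cc1 : ∀ᶠ N : ℕ in atTop, Real.log (Real.log (Real.log N)) + |D₂₀| + (D + 2) * δ⁻¹ ^ 2 ≤
      Real.log (Real.log N) := by
    have a := hv.eventually (eventually_log_le_mul (show (0 : ℝ) < 1 / 2 by norm_num))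
    have b := hv.eventually_ge_atTop (2 * (|D₂₀| + (D + 2) * δ⁻¹ ^ 2))
    filter_upwards [a, b] with N hN hN'
    linarith
  have cc8 : ∀ᶠ N : ℕ in atTop, 320 * Real.log (Real.log (Real.log N)) ≤ Real.log (Real.log N) := by
    have a := hv.eventually (eventually_log_le_mul (show (0 : ℝ) < 1 / 320 by norm_num))
    filter_upwards [a] with N hN
    linarith
  have cc2 : ∀ᶠ N : ℕ in atTop, (2 : ℝ) ^ 20 * Real.exp (D₂₀ + (D + 2) * δ⁻¹ ^ 2) ≤
      Real.log (Real.log N) ^ (2 * δ) :=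
    ((tendsto_rpow_atTop (by positivity)).comp hv).eventually_ge_atTop _
  have cc6 : ∀ᶠ N : ℕ in atTop, (33 : ℝ) ≤ Real.log (Real.log N) ^ (6 * δ) :=
    ((tendsto_rpow_atTop (by positivity)).comp hv).eventually_ge_atTop _
  have cc3 : ∀ᶠ N : ℕ in atTop, 224 * Real.log (Real.log N) ^ 3 ≤ Real.log N ^ (1 / 2 : ℝ) := by
    have a := hu.eventually (eventually_log_pow_le_mul_sqrt 3 (show (0 : ℝ) < 1 / 224 by norm_num))
    filter_upwards [a] with N hN
    linarith
  -- `c4`: `2u(1+2Cu) ≤ exp(u^{1/2}/2)` via `s = u^{1/2}/2 → ∞` and `C' s^4 ≤ e^s`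
  have hs : Tendsto (fun N : ℕ ↦ Real.log N ^ (1 / 2 : ℝ) / 2) atTop atTop :=
    ((tendsto_rpow_atTop (by norm_num)).comp hu).atTop_div_const (by norm_num)
  have cc4 : ∀ᶠ N : ℕ in atTop, 2 * Real.log N * (1 + 2 * C * Real.log N) ≤
      Real.exp (Real.log N ^ (1 / 2 : ℝ) / 2) := by
    have a := hs.eventually (eventually_mul_pow_le_exp (32 + 64 * |C|) 4)
    filter_upwards [a, hu.eventually_ge_atTop (1 : ℝ)] with N hN hu1
    set s := Real.log (N : ℝ) ^ (1 / 2 : ℝ) / 2 with hsdef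
    have hlog0 : 0 ≤ Real.log (N : ℝ) := by linarith
    have hss : Real.log (N : ℝ) = 4 * s ^ 2 := by
      have e : (Real.log (N : ℝ) ^ (1 / 2 : ℝ)) ^ 2 = Real.log N := by
        rw [← Real.rpow_natCast _ 2, ← Real.rpow_mul hlog0]; norm_num
      rw [hsdef, div_pow, e]; ring
    have hs1 : 1 / 4 ≤ s ^ 2 := by nlinarith
    rw [hss]
    -- `2·4s²(1 + 2C·4s²) ≤ 8 s² + 64|C| s⁴ ≤ (32 + 64|C|) s⁴`
    have hC : 2 * (4 * s ^ 2) * (1 + 2 * C * (4 * s ^ 2)) ≤ (32 + 64 * |C|) * s ^ 4 := by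
      have h1 : C * s ^ 4 ≤ |C| * s ^ 4 := mul_le_mul_of_nonneg_right (le_abs_self C) (by positivity)
      nlinarith [sq_nonneg s]
    exact hC.trans hN
  -- `c5`: `Ca (2u)^M ≤ exp(u^{1/2})`
  have hs' : Tendsto (fun N : ℕ ↦ Real.log N ^ (1 / 2 : ℝ)) atTop atTop :=
    (tendsto_rpow_atTop (by norm_num)).comp hu
  have cc5 : ∀ᶠ N : ℕ in atTop, Ca * (2 * Real.log N) ^ M ≤ Real.exp (Real.log N ^ (1 / 2 : ℝ)) := by
    have a := hs'.eventually (eventually_mul_pow_le_exp (Ca * 2 ^ M) (2 * M))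
    filter_upwards [a, hu.eventually_ge_atTop (0 : ℝ)] with N hN hu0
    have e : (2 * Real.log (N : ℝ)) ^ M = 2 ^ M * (Real.log (N : ℝ) ^ (1 / 2 : ℝ)) ^ (2 * M) := by
      rw [mul_pow, pow_mul, ← Real.rpow_natCast _ 2, ← Real.rpow_mul hu0]; norm_num
    rw [e, ← mul_assoc]; exact hN
  have cc7 : ∀ᶠ N : ℕ in atTop, Real.log 4 + (D + 2) * δ⁻¹ ^ 2 ≤ 2 * Real.log (Real.log (Real.log N)) := by
    have a := hw.eventually_ge_atTop ((Real.log 4 + (D + 2) * δ⁻¹ ^ 2) / 2)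
    filter_upwards [a] with N hN
    linarith
  have cc9 : ∀ᶠ N : ℕ in atTop, 32 * D * δ⁻¹ ≤ Real.log (Real.log N) := hv.eventually_ge_atTop _
  obtain ⟨N₁, hN₁⟩ := Filter.eventually_atTop.1 (cN.and (cy2.and (cyu.and (cythr.and (cv6.and (cc1.and
    (cc2.and (cc3.and (cc4.and (cc5.and (cc6.and (cc7.and (cc8.and cc9)))))))))))))
  refine ⟨N₁, fun N hN ↦ ?_⟩
  obtain ⟨a0, a1, a2, a3, a4, a5, a6, a7, a8, a9, a10, a11, a12, a13⟩ := hN₁ N hN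
  exact ⟨a0, a1, a2, a3, a4, a5, a6, a7, a8, a9, a10, a11, a12, a13⟩

end SoundContour

end Literature.NumberTheory.LFunctions

end
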